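import Literature.Analysis.InnerProduct.IsoscelesRightTriangleHeatTraceExpansion
import HarnessLib

/-!
# The NEUMANN isosceles right triangle `T_a = {0 ≤ y ≤ x ≤ a}`: eigenfunctions `cos(mπx/a)cos(nπy/a) + cos(nπx/a)cos(mπy/a)`,
# `m ≥ n ≥ 0` (Band–Bersudsky–Fajman), `Z_N(t) = ½(Z_{N,[0,a]²}(t) + Z_{N,a/√2}(t)) = |T_a|/(4πt) + |∂T_a|/(8√(πt)) + 3/8 + O(t^∞)`
# — the boundary term flips sign, the corner term `3/8` does not; one zero mode, `ζ_N(0) = 3/8 − 1 = −5/8`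

Layer `Literature/Analysis/InnerProduct`, namespace `Literature.Analysis.InnerProduct`; the Neumann companion of row g39-#6
(`IsoscelesRightTriangleHeatTraceExpansion.lean`, IMPORTED: REUSED `kac_corner_terms_isoscelesRightTriangle`,
`isBigO_isoscelesRightTriangle_heatTrace_sub`, `ncard_setOf_isoscelesRightTriangle_eq_zero`), built on the Neumann rectangle and
interval of row g38-#2 (`DirichletRectangleHeatTraceExpansion.lean` §5: `summable_exp_neg_mul_neumannRectangle`,
`isBigO_neumannRectangle_heatTrace_sub`, `summable_exp_neg_mul_neumannInterval`, `isBigO_neumannInterval_heatTrace_sub`,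
`tendsto_neumannInterval_cofinite_atTop`, `tendsto_add_cofinite_atTop`) and the abstract continuation (rows g37-#1/#3/#10:
`Gamma_mul_tsum_cpow_neg_eq_of_expansion`, `tendsto_continuation_nhdsNE_zero`, `tendsto_sub_mul_continuation_nhdsNE`,
`tendsto_ncard_le_div_rpow_of_expansion`). Lane `lit-hodgefound` (Track 2 foundations library), prover seat `lit-hodgefound-p06`
(generation 39), self-proposed row g39-#8. THEOREMS ONLY (no definition, no instance, no notation, no named fact).

## Sources, verbatim

R. Band, M. Bersudsky, D. Fajman, *Courant-sharp eigenvalues of Neumann 2-rep-tiles* (Lett. Math. Phys. 2016; arXiv:1507.03410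
"A note on Courant sharp eigenvalues of the Neumann right-angled isosceles triangle"), §2 (chunk p0006): "We consider the
following scaling for the isosceles right triangle, `D = {(x,y) ∈ [0,π] × [0,π] | y ≤ x}` … the Laplacian is defined on its
interior … Denote `ℕ₀ := ℕ ∪ {0}` and define the set `Q := {(m,n) ∈ ℕ₀ × ℕ₀ | m ≥ n}`, which we call the set of quantum numbers. A
complete orthogonal basis of eigenfunctions is given by `φ_{m,n}(x,y) = cos(mx)cos(ny) + cos(my)cos(nx)`; `(m,n) ∈ Q`, and the
spectrum is given by `σ(D) = {λ_{m,n} = ‖(m,n)‖² | (m,n) ∈ Q}`, where `‖(m,n)‖² = m² + n²`." P. B. Gilkey (1995), §1.9 (the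
interval `[0,A]`: "`Tr e^{−tP_B} ∼ (4πt)^{−1/2}∫{1 + ⋯}dx ∓ ½`", `−` Dirichlet, `+` Neumann), §1.10 Lemma 1.10.1. H. P. McKean,
I. M. Singer (1967), eq. (4a) p. 43–44 (Kac's polygon formula, corner function `(π²−γ²)/(24πγ)`). P. H. Bérard (1986), Ch. III nº31
Exercise (f), Ch. VII nº10 (ii), nº15 (16) (the Neumann counting function).

## The computation

Scaling the legs to `a`: Neumann eigenvalues `π²(m²+n²)/a²`, `m ≥ n ≥ 0`; index `(j,k) ∈ ℕ × ℕ` with `m = j + k`, `n = k`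
(family `(π/a)²((j+k)² + k²)`). The Neumann square `[0,a]²` (`∑_{m,n≥0}`) counts `{m > n}` and `{m < n}` (equal by symmetry) and
the diagonal `{m = n}` (`∑_{n≥0}e^{−2tπ²n²/a²}`, the Neumann interval of length `a/√2`): `Z_{N,[0,a]²} = 2L + D`,
`Z_N(T_a) = L + D`, so `Z_N(T_a) = ½(Z_{N,[0,a]²} + Z_{N,a/√2}) = ½[(a²/(4πt) + 2a/(4√(πt)) + ¼) + ((a/√2)/(2√(πt)) + ½)] + O(t^∞) =
a²/(8πt) + (2a+√2a)/(8√(πt)) + 3/8 + O(t^∞)`: the same area and corner terms as the Dirichlet triangle (row g39-#6), boundary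
term of opposite sign; `Z_N − Z_D = |∂T_a|/(4√(πt)) + O(t^∞)`. One zero mode (`m = n = 0`): `ζ_N(0) = 3/8 − 1 = −5/8`; poles of
`ζ_N` at `1` (residue `a²/(8π)`) and `½` (residue `+(2a+√2a)/(8π)`); Weyl `N(Λ)/Λ → a²/(8π)`.

## What is proved

* §0 private rearrangements `hasSum_nat_prod_trichotomy` (`{x>y} ⊔ {x<y} ⊔ {x=y}`), `hasSum_nat_prod_firstRow` (`{j=0} ⊔ {j≥1}`),
  `sq_pi_div_div_sqrt_two`.
* §1 **`summable_exp_neg_mul_neumannIsoscelesRightTriangle`**, **`tsum_exp_neg_mul_neumannIsoscelesRightTriangle`**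
  (`Z_N = ½(Z_{N,[0,a]²} + Z_{N,a/√2})`), **`isBigO_neumannIsoscelesRightTriangle_heatTrace_sub`** (ALL ORDERS:
  `Z_N − (a²/(8π)t^{−1} + (2a+√2a)/(8√π)t^{−1/2} + 3/8) = O(t^β)`), **`isBigO_neumannIsoscelesRightTriangle_heatTrace_sub_kac`**
  (Kac's shape: `+length/(8√(πt))`, `∑_corners`), `isBigO_neumannIsoscelesRightTriangle_heatTrace_expansion` (`κ = Fin 3`),
  `tendsto_neumannIsoscelesRightTriangle_cofinite_atTop`, `ncard_setOf_neumannIsoscelesRightTriangle_eq_zero` (`= 1`).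
* §2 **`tendsto_ncard_neumannIsoscelesRightTriangle_le_div`** (WEYL `a²/(8π)`),
  **`Gamma_mul_tsum_neumannIsoscelesRightTriangle_cpow_neg_eq`** (LEMMA 1.10.1),
  **`tendsto_neumannIsoscelesRightTriangleZeta_continuation_nhdsNE_zero`** (`ζ_N(0) = −5/8`),
  `tendsto_sub_one_mul_neumannIsoscelesRightTriangleZeta_continuation` (`a²/(8π)`),
  `tendsto_sub_half_mul_neumannIsoscelesRightTriangleZeta_continuation` (`+(2a+√2a)/(8π)`).
* §3 **`isBigO_neumann_sub_dirichlet_isoscelesRightTriangle`** (`Z_N − Z_D − |∂T|/(4√π)t^{−1/2} = O(t^β)`),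
  `not_isospectral_neumann_dirichlet_isoscelesRightTriangle`.

## References

* [BandBersudskyFajman2016] R. Band, M. Bersudsky, D. Fajman, *Courant-sharp eigenvalues of Neumann 2-rep-tiles*, Lett. Math.
  Phys. 107 (2017) 821–859 (arXiv:1507.03410), §2.
* [Gilkey1995] P. B. Gilkey, *Invariance theory, the heat equation, and the Atiyah–Singer index theorem*, 2nd ed., CRC Press
  (1995), §1.7 Lemma 1.7.5 (b), §1.9, §1.10 Lemma 1.10.1.
* [McKeanSinger1967] H. P. McKean, I. M. Singer, *Curvature and the eigenvalues of the Laplacian*, J. Differential Geom. 1 (1967)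
  43–69, eq. (4a).
* [Berard1986] P. H. Bérard, *Spectral Geometry: Direct and Inverse Problems*, Lecture Notes in Math. 1207, Springer (1986),
  Ch. III nº31 Exercise (f); Ch. VII nº10 (ii), nº15.
* [ChristiansonPezzi2024] H. Christianson, D. Pezzi, *Energy distribution for Dirichlet eigenfunctions on right triangles*, J.
  Differential Equations 407 (2024), §3.1 Theorem 8 (the Dirichlet spectrum, row g39-#6).
-/

noncomputable section

open Real Filter Topology Set Asymptotics

namespace Literature.Analysis.InnerProduct

/-! ### §0 Rearrangements of `ℕ × ℕ` and a normalisation -/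

/-- `ℕ² = {x > y} ⊔ {x < y} ⊔ {x = y}` for unconditionally convergent double series (as in the Dirichlet triangle, row g39-#6).
[folklore] -/
private theorem hasSum_nat_prod_trichotomy {F : ℕ × ℕ → ℝ} {l u d : ℝ}
    (hl : HasSum (fun q : ℕ × ℕ ↦ F (q.1 + q.2 + 1, q.2)) l) (hu : HasSum (fun q : ℕ × ℕ ↦ F (q.2, q.1 + q.2 + 1)) u)
    (hd : HasSum (fun n : ℕ ↦ F (n, n)) d) : HasSum F (l + (u + d)) := by
  have hbij : Function.Bijective (Sum.elim (fun q : ℕ × ℕ ↦ (q.1 + q.2 + 1, q.2))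
      (Sum.elim (fun q : ℕ × ℕ ↦ (q.2, q.1 + q.2 + 1)) (fun n : ℕ ↦ (n, n)))) := by
    refine ⟨?_, ?_⟩
    · rintro (⟨r, s⟩ | ⟨r, s⟩ | n) (⟨r', s'⟩ | ⟨r', s'⟩ | n') h <;>
        simp only [Sum.elim_inl, Sum.elim_inr, Sum.inl.injEq, Sum.inr.injEq, Prod.mk.injEq, reduceCtorEq] at h ⊢ <;>
        omega
    · rintro ⟨x, y⟩
      rcases lt_trichotomy y x with hxy | rfl | hxy
      · refine ⟨Sum.inl (x - y - 1, y), ?_⟩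
        show (x - y - 1 + y + 1, y) = (x, y)
        rw [show x - y - 1 + y + 1 = x by omega]
      · exact ⟨Sum.inr (Sum.inr y), rfl⟩
      · refine ⟨Sum.inr (Sum.inl (y - x - 1, x)), ?_⟩
        show (x, y - x - 1 + x + 1) = (x, y)
        rw [show y - x - 1 + x + 1 = y by omega]
  exact (Equiv.ofBijective _ hbij).hasSum_iff.mp
    (HasSum.sum (f := F ∘ Sum.elim (fun q : ℕ × ℕ ↦ (q.1 + q.2 + 1, q.2))
      (Sum.elim (fun q : ℕ × ℕ ↦ (q.2, q.1 + q.2 + 1)) (fun n : ℕ ↦ (n, n)))) hl (HasSum.sum hu hd))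

/-- `ℕ² = {0} × ℕ ⊔ {j ≥ 1} × ℕ`: the quantum numbers `m ≥ n ≥ 0` (`(j,k) ↦ (m,n) = (j+k,k)`) split into the diagonal `m = n`
(`j = 0`) and `m > n` (`j ≥ 1`). [folklore] -/
private theorem hasSum_nat_prod_firstRow {G : ℕ × ℕ → ℝ} {d l : ℝ} (hd : HasSum (fun k : ℕ ↦ G (0, k)) d)
    (hl : HasSum (fun q : ℕ × ℕ ↦ G (q.1 + 1, q.2)) l) : HasSum G (d + l) := by
  have hbij : Function.Bijective (Sum.elim (fun k : ℕ ↦ ((0 : ℕ), k)) (fun q : ℕ × ℕ ↦ (q.1 + 1, q.2))) := by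
    refine ⟨?_, ?_⟩
    · rintro (k | ⟨r, s⟩) (k' | ⟨r', s'⟩) h <;>
        simp only [Sum.elim_inl, Sum.elim_inr, Sum.inl.injEq, Sum.inr.injEq, Prod.mk.injEq, reduceCtorEq, false_and] at h ⊢ <;>
        omega
    · rintro ⟨x, y⟩
      rcases Nat.eq_zero_or_pos x with rfl | hx
      · exact ⟨Sum.inl y, rfl⟩
      · refine ⟨Sum.inr (x - 1, y), ?_⟩
        show (x - 1 + 1, y) = (x, y)
        rw [Nat.sub_add_cancel hx]
  exact (Equiv.ofBijective _ hbij).hasSum_iff.mp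
    (HasSum.sum (f := G ∘ Sum.elim (fun k : ℕ ↦ ((0 : ℕ), k)) (fun q : ℕ × ℕ ↦ (q.1 + 1, q.2))) hd hl)

/-- `(π/(a/√2))² = 2(π/a)²`: the diagonal `m = n` is the Neumann interval of length `a/√2`. [folklore] -/
private theorem sq_pi_div_div_sqrt_two {a : ℝ} : (π / (a / Real.sqrt 2)) ^ 2 = 2 * (π / a) ^ 2 := by
  rw [div_div_eq_mul_div, div_pow, mul_pow, Real.sq_sqrt zero_le_two]
  ring

/-! ### §1 The Neumann spectrum `{π²(m²+n²)/a² : m ≥ n ≥ 0}` and `Z_N = ½(Z_{N,[0,a]²} + Z_{N,a/√2})` -/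

section Triangle

variable {a : ℝ}

/-- **THE NEUMANN SPECTRUM OF THE ISOSCELES RIGHT TRIANGLE AS A FAMILY** — "A complete orthogonal basis of eigenfunctions is
given by `φ_{m,n}(x,y) = cos(mx)cos(ny) + cos(my)cos(nx)`; `(m,n) ∈ Q = {(m,n) ∈ ℕ₀ × ℕ₀ | m ≥ n}`, and the spectrum is given by
`λ_{m,n} = ‖(m,n)‖² = m² + n²`" (legs `π`; for legs `a` scale by `(π/a)²`); index `(j,k) ∈ ℕ × ℕ` with `m = j + k`, `n = k`. The
heat trace converges for `t > 0`. [cite: BandBersudskyFajman2016, §2 (the set of quantum numbers `Q`, the basis `φ_{m,n}` and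
`σ(Δ) = {m² + n² : (m,n) ∈ Q}`)] -/
theorem summable_exp_neg_mul_neumannIsoscelesRightTriangle (ha : 0 < a) {t : ℝ} (ht : 0 < t) :
    Summable fun p : ℕ × ℕ ↦ Real.exp (-(t * ((π / a) ^ 2 * (((p.1 : ℝ) + p.2) ^ 2 + ((p.2 : ℝ)) ^ 2)))) := by
  have hinj : Function.Injective fun q : ℕ × ℕ ↦ (q.1 + q.2, q.2) := by
    rintro ⟨r, s⟩ ⟨r', s'⟩ h
    simp only [Prod.mk.injEq] at h ⊢
    omega
  refine ((summable_exp_neg_mul_neumannRectangle ha ha ht).comp_injective hinj).congr fun q ↦ ?_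
  simp only [Function.comp_apply, Nat.cast_add]
  congr 1
  ring

/-- **`Z_N(T_a)(t) = ½(Z_{N,[0,a]²}(t) + Z_{N,a/√2}(t))`**: `∑_{m≥n≥0} e^{−tπ²(m²+n²)/a²} = ½(∑_{m,n≥0} e^{−tπ²(m²+n²)/a²} +
∑_{n≥0} e^{−2tπ²n²/a²})` — the Neumann square counts the off-diagonal quantum numbers twice and the diagonal once. [cite:
BandBersudskyFajman2016, §2 ("The isosceles right triangle `D` is symmetric with respect to the line … folding"); Gilkey1995, §1.7
Lemma 1.7.5 (b)] -/
theorem tsum_exp_neg_mul_neumannIsoscelesRightTriangle (ha : 0 < a) {t : ℝ} (ht : 0 < t) :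
    ∑' p : ℕ × ℕ, Real.exp (-(t * ((π / a) ^ 2 * (((p.1 : ℝ) + p.2) ^ 2 + ((p.2 : ℝ)) ^ 2)))) =
      ((∑' p : ℕ × ℕ, Real.exp (-(t * ((π / a) ^ 2 * ((p.1 : ℝ)) ^ 2 + (π / a) ^ 2 * ((p.2 : ℝ)) ^ 2)))) +
        ∑' n : ℕ, Real.exp (-(t * (2 * (π / a) ^ 2 * ((n : ℝ)) ^ 2)))) / 2 := by
  have hT := summable_exp_neg_mul_neumannIsoscelesRightTriangle ha ht
  have hDs : Summable fun n : ℕ ↦ Real.exp (-(t * (2 * (π / a) ^ 2 * ((n : ℝ)) ^ 2))) :=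
    (summable_exp_neg_mul_neumannInterval (a := a / Real.sqrt 2) (by positivity) ht).congr fun n ↦ by
      rw [sq_pi_div_div_sqrt_two]
  -- the strictly-lower part `m > n` of the triangle's sum
  have hinj : Function.Injective fun q : ℕ × ℕ ↦ (q.1 + 1, q.2) := by
    rintro ⟨r, s⟩ ⟨r', s'⟩ h
    simp only [Prod.mk.injEq] at h ⊢
    omega
  have hL := (hT.comp_injective hinj).hasSum
  -- the triangle: diagonal + strictly lower
  have hTri := hasSum_nat_prod_firstRow (G := fun p : ℕ × ℕ ↦ Real.exp (-(t * ((π / a) ^ 2 * (((p.1 : ℝ) + p.2) ^ 2 + ((p.2 : ℝ)) ^ 2)))))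
    (hDs.hasSum.congr_fun fun k ↦ by dsimp only; congr 1; push_cast; ring) hL
  -- the square: lower + upper + diagonal
  have hS := hasSum_nat_prod_trichotomy (F := fun p : ℕ × ℕ ↦ Real.exp (-(t * ((π / a) ^ 2 * ((p.1 : ℝ)) ^ 2 + (π / a) ^ 2 * ((p.2 : ℝ)) ^ 2))))
    (hL.congr_fun fun q ↦ by simp only [Function.comp_apply]; congr 1; push_cast; ring)
    (hL.congr_fun fun q ↦ by simp only [Function.comp_apply]; congr 1; push_cast; ring)
    (hDs.hasSum.congr_fun fun n ↦ by dsimp only; congr 1; ring)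
  rw [hTri.tsum_eq, hS.tsum_eq]
  ring

/-- **THE NEUMANN TRIANGLE TO ALL ORDERS: `Z_N(T_a)(t) − (a²/(8π)·t^{−1} + (2a + √2a)/(8√π)·t^{−1/2} + 3/8) = O(t^β)` for EVERY
`β`** — area `|T_a|/(4πt)`, boundary `+|∂T_a|/(8√(πt))` (Neumann sign), corners `3/8 = 1/16 + 5/32 + 5/32` as in the Dirichlet
case, exponentially small remainder: half the sum of the Neumann square (`a²/(4πt) + 2a/(4√(πt)) + ¼`) and the Neumann interval of
length `a/√2` (`(a/√2)/(2√(πt)) + ½`). [cite: Gilkey1995, §1.9 (the interval, Neumann conditions `+½`) with §1.7 Lemma 1.7.5 (b);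
McKeanSinger1967, eq. (4a) p. 43–44 (the corner function `(π²−γ²)/(24πγ)`, here `γ = π/2, π/4, π/4`)] -/
theorem isBigO_neumannIsoscelesRightTriangle_heatTrace_sub (ha : 0 < a) (β : ℝ) :
    (fun t : ℝ ↦ ∑' p : ℕ × ℕ, Real.exp (-(t * ((π / a) ^ 2 * (((p.1 : ℝ) + p.2) ^ 2 + ((p.2 : ℝ)) ^ 2)))) -
      (a ^ 2 / (8 * π) * t ^ (-1 : ℝ) + (2 * a + Real.sqrt 2 * a) / (8 * π ^ (1 / 2 : ℝ)) * t ^ (-(1 / 2 : ℝ)) + 3 / 8))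
      =O[𝓝[>] 0] fun t : ℝ ↦ t ^ β := by
  have hs0 : Real.sqrt 2 ≠ 0 := (Real.sqrt_pos.mpr two_pos).ne'
  have hσ : (Real.sqrt 2)⁻¹ * 2 = Real.sqrt 2 := by
    rw [inv_mul_eq_iff_eq_mul₀ hs0]
    exact (Real.mul_self_sqrt zero_le_two).symm
  have hSq := isBigO_neumannRectangle_heatTrace_sub ha ha β
  have hD := isBigO_neumannInterval_heatTrace_sub (a := a / Real.sqrt 2) (by positivity) β
  refine ((hSq.add hD).const_mul_left (1 / 2)).congr' ?_ EventuallyEq.rfl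
  filter_upwards [self_mem_nhdsWithin] with t (ht : 0 < t)
  rw [tsum_exp_neg_mul_neumannIsoscelesRightTriangle ha ht, sq_pi_div_div_sqrt_two]
  linear_combination (-(a / (8 * π ^ (1 / 2 : ℝ)) * t ^ (-(1 / 2 : ℝ)))) * hσ

/-- **THE NEUMANN TRIANGLE IN KAC'S SHAPE: `Z_N(t) − (area/(4πt) + length/(8√(πt)) + ∑_corners (π²−γ²)/(24πγ)) = O(t^β)`**,
`area = a²/2`, `length = 2a + √2a`, `γ = π/2, π/4, π/4`. [cite: McKeanSinger1967, eq. (4a) p. 43–44 (Dirichlet: `−length`);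
Gilkey1995, §1.9 (Neumann: the boundary term changes sign)] -/
theorem isBigO_neumannIsoscelesRightTriangle_heatTrace_sub_kac (ha : 0 < a) (β : ℝ) :
    (fun t : ℝ ↦ ∑' p : ℕ × ℕ, Real.exp (-(t * ((π / a) ^ 2 * (((p.1 : ℝ) + p.2) ^ 2 + ((p.2 : ℝ)) ^ 2)))) -
      (a ^ 2 / 2 / (4 * π * t) + (2 * a + Real.sqrt 2 * a) / (8 * (π * t) ^ (1 / 2 : ℝ)) +
        ((π ^ 2 - (π / 2) ^ 2) / (24 * π * (π / 2)) + 2 * ((π ^ 2 - (π / 4) ^ 2) / (24 * π * (π / 4)))))) =O[𝓝[>] 0]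
      fun t : ℝ ↦ t ^ β := by
  refine (isBigO_neumannIsoscelesRightTriangle_heatTrace_sub ha β).congr' ?_ EventuallyEq.rfl
  filter_upwards [self_mem_nhdsWithin] with t (ht : 0 < t)
  have hsq : π ^ (1 / 2 : ℝ) * π ^ (1 / 2 : ℝ) = π := by
    rw [← Real.rpow_add Real.pi_pos]; norm_num
  have hs0 : π ^ (1 / 2 : ℝ) ≠ 0 := (Real.rpow_pos_of_pos Real.pi_pos _).ne'
  have hu0 : t ^ (1 / 2 : ℝ) ≠ 0 := (Real.rpow_pos_of_pos ht _).ne'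
  have ht0 : t ≠ 0 := ht.ne'
  rw [kac_corner_terms_isoscelesRightTriangle, Real.mul_rpow Real.pi_pos.le ht.le, Real.rpow_neg_one,
    Real.rpow_neg ht.le]
  congr 1
  set s := π ^ (1 / 2 : ℝ) with hs_def
  set u := t ^ (1 / 2 : ℝ) with hu_def
  rw [show π = s * s from hsq.symm]
  field_simp
  ring

/-- The Neumann triangle expansion in the format of the abstract theory: `κ = Fin 3`, `a = (a²/(8π), +(2a+√2a)/(8√π), 3/8)`,
`α = (−1, −½, 0)`. [cite: Gilkey1995, §1.9, §1.10 Lemma 1.10.1 (the expansion hypothesis)] -/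
theorem isBigO_neumannIsoscelesRightTriangle_heatTrace_expansion (ha : 0 < a) (β : ℝ) :
    (fun t : ℝ ↦ ∑' p : ℕ × ℕ, Real.exp (-(t * ((π / a) ^ 2 * (((p.1 : ℝ) + p.2) ^ 2 + ((p.2 : ℝ)) ^ 2)))) -
      ∑ k : Fin 3, (![a ^ 2 / (8 * π), (2 * a + Real.sqrt 2 * a) / (8 * π ^ (1 / 2 : ℝ)), 3 / 8] : Fin 3 → ℝ) k *
        t ^ ((![(-1 : ℝ), -(1 / 2 : ℝ), 0] : Fin 3 → ℝ) k)) =O[𝓝[>] 0] fun t : ℝ ↦ t ^ β := by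
  refine (isBigO_neumannIsoscelesRightTriangle_heatTrace_sub ha β).congr' ?_ EventuallyEq.rfl
  filter_upwards [self_mem_nhdsWithin] with t (ht : 0 < t)
  simp only [Fin.sum_univ_three, Matrix.cons_val_zero, Matrix.cons_val_one, Matrix.cons_val, Real.rpow_zero, mul_one]

/-- The Neumann spectrum of `T_a` is discrete. [cite: BandBersudskyFajman2016, §2] -/
theorem tendsto_neumannIsoscelesRightTriangle_cofinite_atTop (ha : 0 < a) :
    Tendsto (fun p : ℕ × ℕ ↦ (π / a) ^ 2 * (((p.1 : ℝ) + p.2) ^ 2 + ((p.2 : ℝ)) ^ 2)) cofinite atTop := by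
  have hR := tendsto_add_cofinite_atTop (μ := fun n : ℕ ↦ (π / a) ^ 2 * ((n : ℝ)) ^ 2)
    (ν := fun n : ℕ ↦ (π / a) ^ 2 * ((n : ℝ)) ^ 2) (tendsto_neumannInterval_cofinite_atTop ha)
    (tendsto_neumannInterval_cofinite_atTop ha)
  refine tendsto_atTop_mono (fun p ↦ ?_) hR
  have h0 : (0 : ℝ) ≤ p.1 := p.1.cast_nonneg
  have h0' : (0 : ℝ) ≤ p.2 := p.2.cast_nonneg
  have h1 : ((p.1 : ℝ)) ^ 2 ≤ ((p.1 : ℝ) + p.2) ^ 2 := by nlinarith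
  nlinarith [mul_le_mul_of_nonneg_left h1 (sq_nonneg (π / a))]

/-- **ONE zero mode** (`m = n = 0`, the constants). [cite: BandBersudskyFajman2016, §2 (`(0,0) ∈ Q`, `λ_{0,0} = 0`)] -/
theorem ncard_setOf_neumannIsoscelesRightTriangle_eq_zero (ha : 0 < a) :
    {p : ℕ × ℕ | (π / a) ^ 2 * (((p.1 : ℝ) + p.2) ^ 2 + ((p.2 : ℝ)) ^ 2) = 0}.ncard = 1 := by
  have hc : (π / a) ^ 2 ≠ 0 := by positivity
  have e : {p : ℕ × ℕ | (π / a) ^ 2 * (((p.1 : ℝ) + p.2) ^ 2 + ((p.2 : ℝ)) ^ 2) = 0} = {((0 : ℕ), (0 : ℕ))} := by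
    ext ⟨j, k⟩
    simp only [Set.mem_setOf_eq, Set.mem_singleton_iff, Prod.mk.injEq, mul_eq_zero, hc, false_or]
    constructor
    · intro h
      have hj : (0 : ℝ) ≤ j := j.cast_nonneg
      have hk : (0 : ℝ) ≤ k := k.cast_nonneg
      have hk0 : (k : ℝ) = 0 := by nlinarith [sq_nonneg ((j : ℝ) + k), sq_nonneg (k : ℝ)]
      have hj0 : (j : ℝ) = 0 := by nlinarith [sq_nonneg ((j : ℝ) + k), sq_nonneg (k : ℝ)]
      exact ⟨by exact_mod_cast hj0, by exact_mod_cast hk0⟩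
    · rintro ⟨rfl, rfl⟩
      simp
  rw [e, Set.ncard_singleton]

/-! ### §2 Consequences: Weyl, `Γζ_N` with poles at `1`, `½` and `ζ_N(0) = 3/8 − 1 = −5/8` -/

/-- **WEYL'S LAW FOR THE NEUMANN TRIANGLE: `#{λ ≤ Λ}/Λ → a²/(8π) = |T_a|/(4π)`.** [cite: Berard1986, Ch. VII nº10 (ii), nº15 (16)
(Neumann counting function); McKeanSinger1967, p. 43] -/
theorem tendsto_ncard_neumannIsoscelesRightTriangle_le_div (ha : 0 < a) :
    Tendsto (fun l : ℝ ↦ (({p : ℕ × ℕ | (π / a) ^ 2 * (((p.1 : ℝ) + p.2) ^ 2 + ((p.2 : ℝ)) ^ 2) ≤ l}.ncard : ℕ) : ℝ) / l) atTop (𝓝 (a ^ 2 / (8 * π))) := by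
  have hexp : (fun t : ℝ ↦ ∑' p : ℕ × ℕ, Real.exp (-((π / a) ^ 2 * (((p.1 : ℝ) + p.2) ^ 2 + ((p.2 : ℝ)) ^ 2) * t)) -
      ∑ k : Fin 3, (![a ^ 2 / (8 * π), (2 * a + Real.sqrt 2 * a) / (8 * π ^ (1 / 2 : ℝ)), 3 / 8] : Fin 3 → ℝ) k *
        t ^ ((![(-1 : ℝ), -(1 / 2 : ℝ), 0] : Fin 3 → ℝ) k)) =O[𝓝[>] 0] fun t : ℝ ↦ t ^ (0 : ℝ) := by
    refine (isBigO_neumannIsoscelesRightTriangle_heatTrace_expansion ha 0).congr' ?_ EventuallyEq.rfl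
    filter_upwards with t
    congr 1
    exact tsum_congr fun p ↦ by rw [mul_comm]
  have hsum : ∀ t : ℝ, 0 < t → Summable fun p : ℕ × ℕ ↦ Real.exp (-((π / a) ^ 2 * (((p.1 : ℝ) + p.2) ^ 2 + ((p.2 : ℝ)) ^ 2) * t)) :=
    fun t ht ↦ (summable_exp_neg_mul_neumannIsoscelesRightTriangle ha ht).congr fun p ↦ by rw [mul_comm]
  have h := tendsto_ncard_le_div_rpow_of_expansion (μ := fun p : ℕ × ℕ ↦ (π / a) ^ 2 * (((p.1 : ℝ) + p.2) ^ 2 + ((p.2 : ℝ)) ^ 2)) (ρ := 1)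
    (fun p ↦ by positivity) hsum hexp (fun k ↦ by fin_cases k <;> norm_num) (by norm_num) (by norm_num)
  have e : (∑ k : Fin 3, if (![(-1 : ℝ), -(1 / 2 : ℝ), 0] : Fin 3 → ℝ) k = -1 then
      (![a ^ 2 / (8 * π), (2 * a + Real.sqrt 2 * a) / (8 * π ^ (1 / 2 : ℝ)), 3 / 8] : Fin 3 → ℝ) k else 0) / Real.Gamma (1 + 1) =
      a ^ 2 / (8 * π) := by
    rw [Fin.sum_univ_three]
    simp only [Matrix.cons_val_zero, Matrix.cons_val_one, Matrix.cons_val, if_true,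
      show ¬(-(1 / 2 : ℝ) = -1) by norm_num, show ¬((0 : ℝ) = -1) by norm_num, if_false, add_zero,
      show (1 : ℝ) + 1 = 2 by norm_num, Real.Gamma_two, div_one]
  rw [e] at h
  refine h.congr' ?_
  filter_upwards with l
  rw [Real.rpow_one]

/-- **GILKEY'S LEMMA 1.10.1 FOR THE NEUMANN TRIANGLE: on `Re s > 1`, `Γ(s)·ζ_N(s) = ∑ₖ aₖ/(s + αₖ) − 1/s + r(s)`**,
`(aₖ) = (a²/(8π), (2a+√2a)/(8√π), 3/8)`, `(αₖ) = (−1, −½, 0)`, `r` entire (one zero mode). [cite: Gilkey1995, §1.10 Lemma 1.10.1] -/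
theorem Gamma_mul_tsum_neumannIsoscelesRightTriangle_cpow_neg_eq (ha : 0 < a) {s : ℂ} (hs : 1 < s.re) :
    Complex.Gamma s * ∑' p : {p : ℕ × ℕ | (π / a) ^ 2 * (((p.1 : ℝ) + p.2) ^ 2 + ((p.2 : ℝ)) ^ 2) ≠ 0},
        ((((π / a) ^ 2 * ((((p : ℕ × ℕ).1 : ℝ) + (p : ℕ × ℕ).2) ^ 2 + (((p : ℕ × ℕ).2 : ℝ)) ^ 2)) : ℝ) : ℂ) ^ (-s) =
      (∑ k : Fin 3, ((![a ^ 2 / (8 * π), (2 * a + Real.sqrt 2 * a) / (8 * π ^ (1 / 2 : ℝ)), 3 / 8] : Fin 3 → ℝ) k : ℂ) /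
            (s + ((![(-1 : ℝ), -(1 / 2 : ℝ), 0] : Fin 3 → ℝ) k : ℝ)) -
          ({p : ℕ × ℕ | (π / a) ^ 2 * (((p.1 : ℝ) + p.2) ^ 2 + ((p.2 : ℝ)) ^ 2) = 0}.ncard : ℂ) / s +
        mellin (fun t : ℝ ↦ ((∑' p : {p : ℕ × ℕ | (π / a) ^ 2 * (((p.1 : ℝ) + p.2) ^ 2 + ((p.2 : ℝ)) ^ 2) ≠ 0},
            Real.exp (-(t * ((π / a) ^ 2 * ((((p : ℕ × ℕ).1 : ℝ) + (p : ℕ × ℕ).2) ^ 2 + (((p : ℕ × ℕ).2 : ℝ)) ^ 2)))) : ℝ) : ℂ) -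
          (Ioc 0 1).indicator (fun t : ℝ ↦ ((∑ k : Fin 3, (![a ^ 2 / (8 * π), (2 * a + Real.sqrt 2 * a) / (8 * π ^ (1 / 2 : ℝ)), 3 / 8] : Fin 3 → ℝ) k *
              t ^ ((![(-1 : ℝ), -(1 / 2 : ℝ), 0] : Fin 3 → ℝ) k) : ℝ) : ℂ) -
            ({p : ℕ × ℕ | (π / a) ^ 2 * (((p.1 : ℝ) + p.2) ^ 2 + ((p.2 : ℝ)) ^ 2) = 0}.ncard : ℂ)) t) s) := by
  have h := Gamma_mul_tsum_cpow_neg_eq_of_expansion (μ := fun p : ℕ × ℕ ↦ (π / a) ^ 2 * (((p.1 : ℝ) + p.2) ^ 2 + ((p.2 : ℝ)) ^ 2))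
    (a := ![a ^ 2 / (8 * π), (2 * a + Real.sqrt 2 * a) / (8 * π ^ (1 / 2 : ℝ)), 3 / 8]) (α := ![(-1 : ℝ), -(1 / 2 : ℝ), 0])
    (β := 1) (σ := 1) (fun p ↦ by positivity) (tendsto_neumannIsoscelesRightTriangle_cofinite_atTop ha)
    (fun t ht ↦ summable_exp_neg_mul_neumannIsoscelesRightTriangle ha ht)
    (isBigO_neumannIsoscelesRightTriangle_heatTrace_expansion ha 1) (by norm_num) (by norm_num)
    (fun k ↦ by fin_cases k <;> norm_num) hs
  exact h

/-- **`ζ_N(T_a)(0) = 3/8 − 1 = −5/8`**: the corner coefficient minus the one zero mode. [cite: Gilkey1995, §1.10 Lemma 1.10.1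
(value at `s = 0`, zero-mode correction) with §1.9 (Neumann conditions)] -/
theorem tendsto_neumannIsoscelesRightTriangleZeta_continuation_nhdsNE_zero (ha : 0 < a) :
    Tendsto (fun s : ℂ ↦ (Complex.Gamma s)⁻¹ *
        (∑ k : Fin 3, ((![a ^ 2 / (8 * π), (2 * a + Real.sqrt 2 * a) / (8 * π ^ (1 / 2 : ℝ)), 3 / 8] : Fin 3 → ℝ) k : ℂ) /
            (s + ((![(-1 : ℝ), -(1 / 2 : ℝ), 0] : Fin 3 → ℝ) k : ℝ)) -
          ({p : ℕ × ℕ | (π / a) ^ 2 * (((p.1 : ℝ) + p.2) ^ 2 + ((p.2 : ℝ)) ^ 2) = 0}.ncard : ℂ) / s +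
        mellin (fun t : ℝ ↦ ((∑' p : {p : ℕ × ℕ | (π / a) ^ 2 * (((p.1 : ℝ) + p.2) ^ 2 + ((p.2 : ℝ)) ^ 2) ≠ 0},
            Real.exp (-(t * ((π / a) ^ 2 * ((((p : ℕ × ℕ).1 : ℝ) + (p : ℕ × ℕ).2) ^ 2 + (((p : ℕ × ℕ).2 : ℝ)) ^ 2)))) : ℝ) : ℂ) -
          (Ioc 0 1).indicator (fun t : ℝ ↦ ((∑ k : Fin 3, (![a ^ 2 / (8 * π), (2 * a + Real.sqrt 2 * a) / (8 * π ^ (1 / 2 : ℝ)), 3 / 8] : Fin 3 → ℝ) k *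
              t ^ ((![(-1 : ℝ), -(1 / 2 : ℝ), 0] : Fin 3 → ℝ) k) : ℝ) : ℂ) -
            ({p : ℕ × ℕ | (π / a) ^ 2 * (((p.1 : ℝ) + p.2) ^ 2 + ((p.2 : ℝ)) ^ 2) = 0}.ncard : ℂ)) t) s))
      (𝓝[≠] 0) (𝓝 (-(5 / 8))) := by
  have h := tendsto_continuation_nhdsNE_zero (μ := fun p : ℕ × ℕ ↦ (π / a) ^ 2 * (((p.1 : ℝ) + p.2) ^ 2 + ((p.2 : ℝ)) ^ 2))
    (a := ![a ^ 2 / (8 * π), (2 * a + Real.sqrt 2 * a) / (8 * π ^ (1 / 2 : ℝ)), 3 / 8]) (α := ![(-1 : ℝ), -(1 / 2 : ℝ), 0])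
    (β := 1) (fun p ↦ by positivity) (tendsto_neumannIsoscelesRightTriangle_cofinite_atTop ha)
    (fun t ht ↦ summable_exp_neg_mul_neumannIsoscelesRightTriangle ha ht)
    (isBigO_neumannIsoscelesRightTriangle_heatTrace_expansion ha 1) one_pos
  have e : ((∑ k : Fin 3, if (![(-1 : ℝ), -(1 / 2 : ℝ), 0] : Fin 3 → ℝ) k = 0 then
      ((![a ^ 2 / (8 * π), (2 * a + Real.sqrt 2 * a) / (8 * π ^ (1 / 2 : ℝ)), 3 / 8] : Fin 3 → ℝ) k : ℂ) else 0) -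
      ({p : ℕ × ℕ | (π / a) ^ 2 * (((p.1 : ℝ) + p.2) ^ 2 + ((p.2 : ℝ)) ^ 2) = 0}.ncard : ℂ)) = -(5 / 8) := by
    rw [ncard_setOf_neumannIsoscelesRightTriangle_eq_zero ha, Fin.sum_univ_three]
    simp only [Matrix.cons_val_zero, Matrix.cons_val_one, Matrix.cons_val,
      show ¬((-1 : ℝ) = 0) by norm_num, show ¬(-(1 / 2 : ℝ) = 0) by norm_num, if_false, if_true, zero_add,
      Nat.cast_one]
    push_cast
    ring
  rw [e] at h
  exact h

/-- **Residue `a²/(8π) = |T_a|/(4π)` of `ζ_N` at `s = 1`.** [cite: Gilkey1995, §1.10 Lemma 1.10.1] -/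
theorem tendsto_sub_one_mul_neumannIsoscelesRightTriangleZeta_continuation (ha : 0 < a) :
    Tendsto (fun s : ℂ ↦ (s - (1 : ℝ)) * ((Complex.Gamma s)⁻¹ *
        (∑ k : Fin 3, ((![a ^ 2 / (8 * π), (2 * a + Real.sqrt 2 * a) / (8 * π ^ (1 / 2 : ℝ)), 3 / 8] : Fin 3 → ℝ) k : ℂ) /
            (s + ((![(-1 : ℝ), -(1 / 2 : ℝ), 0] : Fin 3 → ℝ) k : ℝ)) -
          ({p : ℕ × ℕ | (π / a) ^ 2 * (((p.1 : ℝ) + p.2) ^ 2 + ((p.2 : ℝ)) ^ 2) = 0}.ncard : ℂ) / s +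
        mellin (fun t : ℝ ↦ ((∑' p : {p : ℕ × ℕ | (π / a) ^ 2 * (((p.1 : ℝ) + p.2) ^ 2 + ((p.2 : ℝ)) ^ 2) ≠ 0},
            Real.exp (-(t * ((π / a) ^ 2 * ((((p : ℕ × ℕ).1 : ℝ) + (p : ℕ × ℕ).2) ^ 2 + (((p : ℕ × ℕ).2 : ℝ)) ^ 2)))) : ℝ) : ℂ) -
          (Ioc 0 1).indicator (fun t : ℝ ↦ ((∑ k : Fin 3, (![a ^ 2 / (8 * π), (2 * a + Real.sqrt 2 * a) / (8 * π ^ (1 / 2 : ℝ)), 3 / 8] : Fin 3 → ℝ) k *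
              t ^ ((![(-1 : ℝ), -(1 / 2 : ℝ), 0] : Fin 3 → ℝ) k) : ℝ) : ℂ) -
            ({p : ℕ × ℕ | (π / a) ^ 2 * (((p.1 : ℝ) + p.2) ^ 2 + ((p.2 : ℝ)) ^ 2) = 0}.ncard : ℂ)) t) s)))
      (𝓝[≠] ((1 : ℝ) : ℂ)) (𝓝 ((a ^ 2 / (8 * π) : ℝ) : ℂ)) := by
  have h := tendsto_sub_mul_continuation_nhdsNE (μ := fun p : ℕ × ℕ ↦ (π / a) ^ 2 * (((p.1 : ℝ) + p.2) ^ 2 + ((p.2 : ℝ)) ^ 2))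
    (a := ![a ^ 2 / (8 * π), (2 * a + Real.sqrt 2 * a) / (8 * π ^ (1 / 2 : ℝ)), 3 / 8]) (α := ![(-1 : ℝ), -(1 / 2 : ℝ), 0])
    (β := 1) (fun p ↦ by positivity) (tendsto_neumannIsoscelesRightTriangle_cofinite_atTop ha)
    (fun t ht ↦ summable_exp_neg_mul_neumannIsoscelesRightTriangle ha ht)
    (isBigO_neumannIsoscelesRightTriangle_heatTrace_expansion ha 1) (s₀ := 1) (by norm_num)
  have e : (Complex.Gamma ((1 : ℝ) : ℂ))⁻¹ *
      ((∑ k : Fin 3, if (![(-1 : ℝ), -(1 / 2 : ℝ), 0] : Fin 3 → ℝ) k = -(1 : ℝ) then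
        ((![a ^ 2 / (8 * π), (2 * a + Real.sqrt 2 * a) / (8 * π ^ (1 / 2 : ℝ)), 3 / 8] : Fin 3 → ℝ) k : ℂ) else 0) -
        if (1 : ℝ) = 0 then ({p : ℕ × ℕ | (π / a) ^ 2 * (((p.1 : ℝ) + p.2) ^ 2 + ((p.2 : ℝ)) ^ 2) = 0}.ncard : ℂ) else 0) =
      ((a ^ 2 / (8 * π) : ℝ) : ℂ) := by
    rw [Fin.sum_univ_three]
    simp only [Matrix.cons_val_zero, Matrix.cons_val_one, Matrix.cons_val, if_true,
      show ¬(-(1 / 2 : ℝ) = -1) by norm_num, show ¬((0 : ℝ) = -1) by norm_num, if_false, add_zero, one_ne_zero,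
      sub_zero, Complex.ofReal_one, Complex.Gamma_one, inv_one, one_mul]
  rw [e] at h
  exact h

/-- **Residue `+(2a+√2a)/(8π) = +|∂T_a|/(8π)` of `ζ_N` at `s = ½`** (opposite in sign to the Dirichlet triangle's).
[cite: Gilkey1995, §1.10 Lemma 1.10.1, §1.9] -/
theorem tendsto_sub_half_mul_neumannIsoscelesRightTriangleZeta_continuation (ha : 0 < a) :
    Tendsto (fun s : ℂ ↦ (s - (1 / 2 : ℝ)) * ((Complex.Gamma s)⁻¹ *
        (∑ k : Fin 3, ((![a ^ 2 / (8 * π), (2 * a + Real.sqrt 2 * a) / (8 * π ^ (1 / 2 : ℝ)), 3 / 8] : Fin 3 → ℝ) k : ℂ) /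
            (s + ((![(-1 : ℝ), -(1 / 2 : ℝ), 0] : Fin 3 → ℝ) k : ℝ)) -
          ({p : ℕ × ℕ | (π / a) ^ 2 * (((p.1 : ℝ) + p.2) ^ 2 + ((p.2 : ℝ)) ^ 2) = 0}.ncard : ℂ) / s +
        mellin (fun t : ℝ ↦ ((∑' p : {p : ℕ × ℕ | (π / a) ^ 2 * (((p.1 : ℝ) + p.2) ^ 2 + ((p.2 : ℝ)) ^ 2) ≠ 0},
            Real.exp (-(t * ((π / a) ^ 2 * ((((p : ℕ × ℕ).1 : ℝ) + (p : ℕ × ℕ).2) ^ 2 + (((p : ℕ × ℕ).2 : ℝ)) ^ 2)))) : ℝ) : ℂ) -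
          (Ioc 0 1).indicator (fun t : ℝ ↦ ((∑ k : Fin 3, (![a ^ 2 / (8 * π), (2 * a + Real.sqrt 2 * a) / (8 * π ^ (1 / 2 : ℝ)), 3 / 8] : Fin 3 → ℝ) k *
              t ^ ((![(-1 : ℝ), -(1 / 2 : ℝ), 0] : Fin 3 → ℝ) k) : ℝ) : ℂ) -
            ({p : ℕ × ℕ | (π / a) ^ 2 * (((p.1 : ℝ) + p.2) ^ 2 + ((p.2 : ℝ)) ^ 2) = 0}.ncard : ℂ)) t) s)))
      (𝓝[≠] ((1 / 2 : ℝ) : ℂ)) (𝓝 ((((2 * a + Real.sqrt 2 * a) / (8 * π)) : ℝ) : ℂ)) := by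
  have h := tendsto_sub_mul_continuation_nhdsNE (μ := fun p : ℕ × ℕ ↦ (π / a) ^ 2 * (((p.1 : ℝ) + p.2) ^ 2 + ((p.2 : ℝ)) ^ 2))
    (a := ![a ^ 2 / (8 * π), (2 * a + Real.sqrt 2 * a) / (8 * π ^ (1 / 2 : ℝ)), 3 / 8]) (α := ![(-1 : ℝ), -(1 / 2 : ℝ), 0])
    (β := 1) (fun p ↦ by positivity) (tendsto_neumannIsoscelesRightTriangle_cofinite_atTop ha)
    (fun t ht ↦ summable_exp_neg_mul_neumannIsoscelesRightTriangle ha ht)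
    (isBigO_neumannIsoscelesRightTriangle_heatTrace_expansion ha 1) (s₀ := 1 / 2) (by norm_num)
  have hsq : π ^ (1 / 2 : ℝ) * π ^ (1 / 2 : ℝ) = π := by
    rw [← Real.rpow_add Real.pi_pos]; norm_num
  have hs0 : π ^ (1 / 2 : ℝ) ≠ 0 := (Real.rpow_pos_of_pos Real.pi_pos _).ne'
  have e : (Complex.Gamma ((1 / 2 : ℝ) : ℂ))⁻¹ *
      ((∑ k : Fin 3, if (![(-1 : ℝ), -(1 / 2 : ℝ), 0] : Fin 3 → ℝ) k = -(1 / 2 : ℝ) then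
        ((![a ^ 2 / (8 * π), (2 * a + Real.sqrt 2 * a) / (8 * π ^ (1 / 2 : ℝ)), 3 / 8] : Fin 3 → ℝ) k : ℂ) else 0) -
        if (1 / 2 : ℝ) = 0 then ({p : ℕ × ℕ | (π / a) ^ 2 * (((p.1 : ℝ) + p.2) ^ 2 + ((p.2 : ℝ)) ^ 2) = 0}.ncard : ℂ) else 0) =
      ((((2 * a + Real.sqrt 2 * a) / (8 * π)) : ℝ) : ℂ) := by
    rw [Fin.sum_univ_three]
    simp only [Matrix.cons_val_zero, Matrix.cons_val_one, Matrix.cons_val, if_true,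
      show ¬((-1 : ℝ) = -(1 / 2)) by norm_num, show ¬((0 : ℝ) = -(1 / 2)) by norm_num,
      show ¬((1 / 2 : ℝ) = 0) by norm_num, if_false, add_zero, zero_add, sub_zero, Complex.Gamma_ofReal,
      Real.Gamma_one_half_eq, Real.sqrt_eq_rpow, ← Complex.ofReal_inv, ← Complex.ofReal_mul]
    congr 1
    set s := π ^ (1 / 2 : ℝ) with hs_def
    rw [show π = s * s from hsq.symm]
    field_simp
  rw [e] at h
  exact h

end Triangle

/-! ### §3 Dirichlet versus Neumann on the same triangle: "one can hear the boundary condition" -/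

section DirichletVsNeumann

variable {a : ℝ}

/-- **`Z_N(T_a)(t) − Z_D(T_a)(t) − (2a + √2a)/(4√π)·t^{−1/2} = O(t^β)` for every `β`**: the Neumann and Dirichlet heat traces of
the same triangle differ by the full boundary term `|∂T_a|/(4√(πt))` (the area and corner terms cancel), up to `O(t^∞)` (row
g39-#6 `isBigO_isoscelesRightTriangle_heatTrace_sub`). [cite: Gilkey1995, §1.9 (`∓½` per end point: Dirichlet `−`, Neumann `+`);
McKeanSinger1967, eq. (4a)] -/
theorem isBigO_neumann_sub_dirichlet_isoscelesRightTriangle (ha : 0 < a) (β : ℝ) :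
    (fun t : ℝ ↦ ∑' p : ℕ × ℕ, Real.exp (-(t * ((π / a) ^ 2 * (((p.1 : ℝ) + p.2) ^ 2 + ((p.2 : ℝ)) ^ 2)))) -
      ∑' p : ℕ × ℕ, Real.exp (-(t * ((π / a) ^ 2 * (((p.1 : ℝ) + p.2 + 2) ^ 2 + ((p.2 : ℝ) + 1) ^ 2)))) -
      (2 * a + Real.sqrt 2 * a) / (4 * π ^ (1 / 2 : ℝ)) * t ^ (-(1 / 2 : ℝ))) =O[𝓝[>] 0] fun t : ℝ ↦ t ^ β := by
  have hN := isBigO_neumannIsoscelesRightTriangle_heatTrace_sub ha β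
  have hD := isBigO_isoscelesRightTriangle_heatTrace_sub ha β
  refine (hN.sub hD).congr' ?_ EventuallyEq.rfl
  filter_upwards with t
  ring

/-- **The Dirichlet and Neumann problems on `T_a` are not isospectral** (`0` is a Neumann eigenvalue, of multiplicity one, and not
a Dirichlet eigenvalue). [cite: BandBersudskyFajman2016, §2; ChristiansonPezzi2024, §3.1 Theorem 8] -/
theorem not_isospectral_neumann_dirichlet_isoscelesRightTriangle (ha : 0 < a) :
    ¬ ∀ x : ℝ, {p : ℕ × ℕ | (π / a) ^ 2 * (((p.1 : ℝ) + p.2) ^ 2 + ((p.2 : ℝ)) ^ 2) = x}.ncard =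
      {p : ℕ × ℕ | (π / a) ^ 2 * (((p.1 : ℝ) + p.2 + 2) ^ 2 + ((p.2 : ℝ) + 1) ^ 2) = x}.ncard := by
  intro h
  have h0 := h 0
  rw [ncard_setOf_neumannIsoscelesRightTriangle_eq_zero ha, ncard_setOf_isoscelesRightTriangle_eq_zero ha] at h0
  omega

end DirichletVsNeumann

end Literature.Analysis.InnerProduct
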